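import Summits.QuantumFields.BalabanUV.Beta.D1BFx.RoadEndBFxDictPointwiseS
import Summits.QuantumFields.BalabanUV.Beta.CombChartJointEnd

/-!
# `BalabanUV.Beta.D1BFx.RoadEndBFxJointCombShSym` — road «BF-x» for binder row D1: **THE JOINT ROOT OVER THE CHART-(III′) LITERAL `JsB12CombShSym`** —
# the row-D1 owner an2's JetData-level END `CombChartJointEnd.d1Drift_JsB12CombShSym_of_hW_reflLettersRem_D1Tel_D1Rep` (p313210 ✓) with its LAST binder
# `hrep : D1Rep Lc Jc N μ ν a SL k` SUPPLIED by road «BF-x»'s pointwise-dictionary END `RoadEndBFxDictPointwiseS.d1Rep_BFx_of_D1Tel_ptw_sbpS` (p306436 ✓) read at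
# `Js := JsB12CombShSym …` (its `hRfl` = an2's §3 `axisReflectionCovariant_flipK_TbalOf_JsB12CombShSym_of_reflLettersRem` from the SAME reflection letters).

HONEST DEPENDENCY (cell records, verbatim): «continuum YM on T⁴ ⇐ BetaPertH ∧ nine spine estimates (0/9 proved); BetaPertH ⇐ (D1) ∧ (D4) ∧
CAP+tail; G-an2-4 gates asym, D1 and NE2/3/4.»  HONEST FRAMING (cell contract, verbatim): «discharging `BetaPertH` makes Bałaban's UV stability
UNCONDITIONAL — a real constructive-QFT result; it is NOT the continuum limit and NOT the Clay problem.»  THIS MODULE DISCHARGES NO BINDER OF THE ROW: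
it is ONE composition BY NAME that puts the two roads' DISPLAYED letters side by side under one conclusion `D1Drift Lc (JsB12CombShSym …) N μ ν` for the
chart-(III′) literal: an2's `hW` (direct binder), the reflection letters (Sr-conj)∕(Wr-conj-rem) with diagonal contacts and the tadpole-null remainder `hRm0`,
`D1Tel` (road FP), the printed [B5] facts `h12`∕`h126`, the window; and road «BF-x»'s (K) slot in POINTWISE currency (`Rk hptw hMR hRu hU₁`), its loop-weight
tie, pins and ray, slot-table sockets, `hdiv`, the Λ∕R∕Q letters and the unit rows `hU`.  Root-level classes of the repair track {hW, hR-letters + `hRm0`,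
D1Tel, D1Rep} — here D1Rep is REPLACED by road «BF-x»'s displayed rows, NOT discharged: 0∕4 classes discharged; (K) NOT closed; NOT D1, NOT `BetaPertH`,
NOT continuum, NOT Clay.  No definition, no `def … : Prop`, nothing cited, 0 sorry.

ABSOLUTE RULE (cell charter, verbatim): «No internally-minted statement may enter as a cited fact. Every hypothesis is either kernel-proved in this
package or a verbatim quotation of a PUBLISHED theorem with page reference. The manuscript(s) under audit are NOT citable for their own disputed
steps — they are the thing under adjudication; programme-internal (2001/route/tribunal) claims are never citable.»

WHY (owner d1-p2 memo g15 §3 item 0 ∕ g16 §3; an2 g35 R-D1-g35-4 «packaging = (III′) first»; W-d1p2-g16-7): the two roads of row D1 meet at the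
(III′) literal.  `nOf`∕`hn1`∕`MOf` (road BF-x's names) are an2's `fun i => (i.1 : ℕ)` ∕ `fun i => i.1.pos` ∕ `MvE` on the nose (abbrevs), so the [B5] binders are shared.
an2's table-size parameter is renamed `Nt` and its Λ table weight `cΛ′` here (road BF-x's `N : ℝ` is the (1.22) normalisation and `cΛ : ℕ → ℝ` its Λ-pin family).
Unit `b2b-balaban-beta-d1-p2` (road «BF-x» owner, gen 16), 2026-08-22.
-/

noncomputable section

open Finset Filter Topology
open Literature.Probability.LatticeModels (annulus)
open scoped BigOperators
open Literature.MathematicalPhysics.QuantumFieldTheory.Balaban1983to89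
open Literature.MathematicalPhysics.QuantumFieldTheory.Balaban1983to89.Beta
open OneStepResolventKernel (JetData KInv)
open OneStepKernelFamily (TbalOf TshotOf flipK D1Tel D1Rep D1Drift)
open PolarizationSign (WardTransversal AxisReflectionCovariant)
open StepDriftWitness (D1Sum d1Sum_iff d1Sum_of_d1Tel d1Rep_iff_d1Drift_of_d1Sum)
open InterLevelTransport (onLat)
open BalabanStepJets (lamCoeffOf)
open AveragingHessianKernels (hessFF)
open KernelWard (divV)
open WindowIdentification (fullSum psum)
open B12Sec2to5 (l1)
open DyadicShell (Pt toReal supNorm)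
open ExpKernelCalculus (Site MKer BiLoc shiftK comp VertexFamily VertexFamily₂)
open DecimatedMomentSummable (AbsMoment₂)
open DecimatedMomentSummable (IsMoment₂ summable_smul_of_absMoment₂)
open GhostTable (gFree)
open BubbleTransfer (unitVec)
open DressedMomentNormalisation (resSite)
open PoissonInterior (nrm)
open Summit.QuantumFields.BalabanUV.Beta.TameKernelCalculus (Spr Loc trK)
open Summit.QuantumFields.BalabanUV.Beta.D1BFx.ReducedKernel (TableR TOfRed vertexRed absMoment₂_TOfRed)
open Summit.QuantumFields.BalabanUV.Beta.D1BFx.DressedTadpoleTable (tableRed tadpoleTable)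
open Summit.QuantumFields.BalabanUV.Beta.D1BFx.ReducedKernelSandwich (fineHess)
open Summit.QuantumFields.BalabanUV.Beta.D1BFx.ReducedTableBridge (vertexFamily₂_tableRed')
open Summit.QuantumFields.BalabanUV.Beta.D1BFx.FineStencilBF (ffOf)
open Summit.QuantumFields.BalabanUV.Beta.D1BFx.FineStencilBFBalaban (SbfBal exists_vertexFamily_vertexRed_SbfBal)
open Summit.QuantumFields.BalabanUV.Beta.D1BFx.SecondStencilBF (Wbf biLoc_Wbf)
open Summit.QuantumFields.BalabanUV.Beta.D1BFx.GhostKernelComplete (PghQ fineHessGhQ absMoment₂_PghQ)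
open Summit.QuantumFields.BalabanUV.Beta.D1BFx.GluonLeg (Ga)
open Summit.QuantumFields.BalabanUV.Beta.D1BFx.GluonLegTails (hGa_of_prop12)
open Summit.QuantumFields.BalabanUV.Beta.D1BFx.FrozenLegTails (nOf MOf hn1)
open Summit.QuantumFields.BalabanUV.Beta.D1BFx.FrozenLegProfile (gfrz)
open VectorTailsLoc (fam kfam)
open Summit.QuantumFields.BalabanUV.Beta.D1BFx.RoadEndBFxSpineDictS (d1Rep_BFx_of_D1Tel_dict_sbpS)
open Finset
open Literature.MathematicalPhysics.QuantumFieldTheory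
open Literature.MathematicalPhysics.QuantumFieldTheory.Balaban1983to89.Beta.VectorTailsLoc (fam kfam)
open Literature.MathematicalPhysics.QuantumFieldTheory.Balaban1983to89.Beta.VectorLegVolumeAdapter (MvE)
open ExpKernelCalculus (MKer Decays BiLoc comp tr tadpole hessKer shiftK)
open AffineAveraging (box toSite)
open AveragingContoursRooted (ctr ctrOff ctrOff_mem_box)
open PolarizationSign (reflSign WardTransversal AxisReflectionCovariant)
open KernelReflection (refK)
open ResolventReflection (bref Φ)
open OneStepResolventKernel (Fib LocStencil JetData)
open OneStepKernelFamily (KInvStep vertexOfK TstepOf TbalOf flipK D1Tel D1Rep D1Drift d1Drift_of_D1Tel_D1Rep)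
open Summit.QuantumFields.BalabanUV.Beta.TameKernelCalculus
open Summit.QuantumFields.BalabanUV.Beta.ChartConjugation (conjV conjW)
open Summit.QuantumFields.BalabanUV.Beta.ChartConjugationRelative (RelInv)
open Summit.QuantumFields.BalabanUV.Beta.ChartConjugationRemainderEnd (axisReflectionCovariant_flipK_hessKer_conj_rem_rel)
open Summit.QuantumFields.BalabanUV.Beta.AxialDressingRooted (one_le_of_neZero dressAt coDressKAt axEc spr_axEc hessKer_dressAt)
open Summit.QuantumFields.BalabanUV.Beta.SymmetrisedDressingKernel (coDressKSymAt)
open Summit.QuantumFields.BalabanUV.Beta.SymmetrisedDressingDress (dressSymAt)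
open Summit.QuantumFields.BalabanUV.Beta.SymmetrisedDressingHessian (TstepOf_dressSymAt decays_coDressKSymAt_KInvStep)
open Summit.QuantumFields.BalabanUV.Beta.SymmetrisedStepJets (SymTables Gsym)
open Summit.QuantumFields.BalabanUV.Beta.SymShiftedSpread (bhKStepSh spr_bhKStepSh)
open Summit.QuantumFields.BalabanUV.Beta.DshAn1 (Dsh spr_Dsh)
open Summit.QuantumFields.BalabanUV.Beta.BorderedHessian (diagK comp_axEc_diagK_comm)
open Summit.QuantumFields.BalabanUV.Beta.CombChartResolventRules (refK_coDressKAt_Gsym)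
open Summit.QuantumFields.BalabanUV.Beta.CombChartStepJets (GcombSh JsB12CombSh0 JsB12CombSh)
open Summit.QuantumFields.BalabanUV.Beta.RelInvCombShiftedSpread (relInv_coDressKAt_Gsym_bhKStepSh)
open Summit.QuantumFields.BalabanUV.Beta.CombChartJointEnd (JsB12CombShSym d1Drift_JsB12CombShSym_of_hW_reflLettersRem_D1Tel_D1Rep
  axisReflectionCovariant_flipK_TbalOf_JsB12CombShSym_of_reflLettersRem)
open Summit.QuantumFields.BalabanUV.Beta.D1BFx.RoadEndBFxDictPointwiseS (d1Rep_BFx_of_D1Tel_ptw_sbpS)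

namespace Summit.QuantumFields.BalabanUV.Beta.D1BFx.RoadEndBFxJointCombShSym

variable {Lc : ℕ} [NeZero Lc] {N cgh₀ : ℝ} {μ ν : Fin 4} {υ : Type*} [Fintype υ]
  {cE cVH cΛ cR cK cQ cE₂ cJ4 cΛ₂ cR₂ cQ₂ x₀ ωgl ωgh cgh : ℕ → ℝ} {WE WJ WΛ WR WQ : ℕ → TableR} {CE CJ CΛt CRt CQ δW : ℕ → ℝ}
  {Ru : υ → ℕ → ℝ} {CU : υ → ℝ} {U₁ : ℝ}
  {TΛ WA : ℕ → Fin 4 → Site 4 → Fin 4 → Site 4 → MKer 4 (Fin 4)} {CT δT : ℕ → ℝ}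
  {ε : ℕ → ℝ} {X : ℕ → Site 4 → MKer 4 (Fin 4)} {Cx δx : ℕ → ℝ}

/-- **THE JOINT ROOT OF ROW D1 OVER THE CHART-(III′) LITERAL**: `D1Drift Lc (JsB12CombShSym hLc Nt tabs cΛ′ cB) N μ ν` from an2's JetData-level END with
`hrep` supplied by road «BF-x»'s pointwise-dictionary END (`d1Rep_BFx_of_D1Tel_ptw_sbpS` at `Js := JsB12CombShSym …`, `hRfl` := an2's §3 from the SAME
reflection letters, `hW`∕`htel` the SAME binders).  Every letter of both roads is DISPLAYED; nothing is discharged.  The window of an2's END is displayed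
(`cc`, `Mw`); road BF-x's own window is discharged inside its END at `M := id`. -/
theorem d1Drift_JsB12CombShSym_BFx (hLc : Odd Lc) (hL2 : 2 ≤ Lc) (Nt : ℕ) (tabs : SymTables 3 Lc) (cΛ' cB : ℝ)
    -- hW: a direct binder (the (III′) Ward END is not in this file)
    (hW : ∀ j, WardTransversal (flipK (TbalOf Lc (JsB12CombShSym hLc Nt tabs cΛ' cB) j)))
    -- hR: the reflection letters of the undressed comb-chart jets, diagonal contacts, tadpole-null remainder
    (c : ℕ → Fin 4 → Fin 4 → (Fin 4 → ℤ) → (Fin 4 → ℤ) → Fib 3 → ℝ) (Cc δc : ℕ → ℝ)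
    (hC : ∀ j α, LocStencil (fun κ u => diagK (c j α κ u)) (Cc j) (δc j)) (hδc : ∀ j, 0 < δc j)
    (x₂ : ℕ → Fin 4 → Fin 4 → (Fin 4 → ℤ) → Fin 4 → (Fin 4 → ℤ) → (Fin 4 → ℤ) → Fib 3 → ℝ)
    (hX₂ : ∀ j α μ y ν y', Loc (diagK (x₂ j α μ y ν y')))
    (Rm : ℕ → Fin 4 → Fin 4 → (Fin 4 → ℤ) → Fin 4 → (Fin 4 → ℤ) → MKer 4 (Fib 3))
    (hRmL : ∀ j α μ y ν y', Loc (Rm j α μ y ν y'))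
    (hRm0 : ∀ j α μ y ν y', tadpole (GcombSh Lc j) (Rm j α μ y ν y') = 0)
    (hSrC : ∀ (j : ℕ) (α κ' : Fin 4) (u : Fin 4 → ℤ),
      (JsB12CombSh0 hLc Nt tabs cΛ' cB j).S κ' (bref α κ' u) =
        reflSign α κ' • refK (Φ Lc α) ((JsB12CombSh0 hLc Nt tabs cΛ' cB j).S κ' u + conjV (bhKStepSh 3 Lc (Dsh Lc) j) (diagK (c j α κ' u))))
    (hWrC : ∀ (j : ℕ) (α μ : Fin 4) (y : Fin 4 → ℤ) (ν : Fin 4) (y' : Fin 4 → ℤ),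
      (JsB12CombSh0 hLc Nt tabs cΛ' cB j).W μ (bref α μ y) ν (bref α ν y') = (reflSign α μ * reflSign α ν) • refK (Φ Lc α)
        ((JsB12CombSh0 hLc Nt tabs cΛ' cB j).W μ y ν y' +
          conjW (bhKStepSh 3 Lc (Dsh Lc) j) (vertexOfK (GcombSh Lc j) Lc (JsB12CombSh0 hLc Nt tabs cΛ' cB j).S μ y)
            (vertexOfK (GcombSh Lc j) Lc (JsB12CombSh0 hLc Nt tabs cΛ' cB j).S ν y')
            (vertexOfK (GcombSh Lc j) Lc (fun κ u => diagK (c j α κ u)) μ y) (vertexOfK (GcombSh Lc j) Lc (fun κ u => diagK (c j α κ u)) ν y')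
            (diagK (x₂ j α μ y ν y')) + Rm j α μ y ν y'))
    -- the route theorem's own binders (printed B5 facts, channel, colour parameter, window), verbatim
    (a : ℝ) (ha : 0 < a)
    (h12 : B5.Prop12Printed (fam nOf hn1 MOf a ha)) (h126 : B5.Kernel126_127Printed (kfam nOf MOf))
    {L : Type*} {SL : Finset L} (hSL : SL.Nonempty) (k : L → Fin 4) (hμν : μ ≠ ν) (hN : N ≠ 0)
    (Jc : ∀ m : ℕ, JetData 3 (Lc ^ m)) (htel : D1Tel Lc (JsB12CombShSym hLc Nt tabs cΛ' cB) Jc)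
    {cc : ℝ} {Mw : ℕ → ℕ} (hc : 1 ≤ cc) (hMw : ∀ L : ℕ, 2 ≤ L → 1 ≤ Mw L ∧ (L : ℝ) ≤ cc * Mw L) (hML : ∀ L : ℕ, 2 ≤ L → Mw L ≤ L)
    -- ROAD «BF-x»: the (K) slot in POINTWISE currency and the END's rows (binders of `d1Rep_BFx_of_D1Tel_ptw_sbpS`, verbatim)
    -- THE (K) SLOT IN POINTWISE CURRENCY: rest-word kernels `Rk`, the pointwise dictionary `hptw`, the rest kernels' moments and their read-out slack
    (Rk : υ → ℕ → Fin 4 → Fin 4 → Site 4 → ℝ) {CU' : υ → ℝ}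
    (hptw : ∀ m : ℕ, 1 ≤ m → ∀ z : Site 4, TshotOf Lc Jc m μ ν z =
      ωgl (Lc ^ m) * TOfRed (Lc ^ m) a
          (SbfBal (Lc ^ m) a (cE (Lc ^ m)) (cVH (Lc ^ m)) (cΛ (Lc ^ m)) (cR (Lc ^ m)) (cK (Lc ^ m)) (cQ (Lc ^ m)))
          (tableRed (Lc ^ m) (Wbf (cE₂ (Lc ^ m)) (cJ4 (Lc ^ m)) (cΛ₂ (Lc ^ m)) (cR₂ (Lc ^ m)) (cQ₂ (Lc ^ m))
            (WE (Lc ^ m)) (WJ (Lc ^ m)) (WΛ (Lc ^ m)) (WR (Lc ^ m)) (WQ (Lc ^ m)))) μ ν z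
        + ωgh (Lc ^ m) * PghQ (Lc ^ m) a (x₀ (Lc ^ m)) (cK (Lc ^ m)) (cQ (Lc ^ m)) μ ν z
        + ∑ u, Rk u (Lc ^ m) μ ν z)
    (hMR : ∀ (u : υ) (m : ℕ), 1 ≤ m → AbsMoment₂ (Rk u (Lc ^ m) μ ν))
    (hRu : ∀ (u : υ) (m : ℕ), 1 ≤ m → |B12Beta.secondMoment (Rk u (Lc ^ m)) μ ν - Ru u (Lc ^ m)| ≤ CU' u)
    (hU₁ : ∑ u, CU' u ≤ U₁)
    -- the RESCALED loop-weight tie of reading (ii): displayed scalar family `s`, pinned `s n = n⁻²`; the normalisation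
    (s : ℕ → ℝ) (hs : ∀ n : ℕ, 2 ≤ n → s n = ((n : ℝ) ^ 2)⁻¹) (hωs : ∀ n : ℕ, 2 ≤ n → ωgh n * (s n * cK n) ^ 2 = -2 * (ωgl n * cE n ^ 2))
    (hlam : ∀ n : ℕ, 2 ≤ n → ωgl n * cE n ^ 2 = 2 * N ^ 2 * (n : ℝ) ^ 8)
    -- pins and the ray (the rows' letters)
    (hcE : ∀ n : ℕ, 2 ≤ n → cE n = (n : ℝ) ^ 4) (hRsgn : ∀ n : ℕ, 2 ≤ n → cR n = -cE n) (hJ4 : ∀ n : ℕ, cJ4 n = 0)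
    (hcgh : ∀ n : ℕ, |cgh n| ≤ cgh₀) (hKray : ∀ n : ℕ, cK n = cgh n * (n : ℝ) ^ 2) (hQray : ∀ n : ℕ, cQ n = cgh n * a) (hx : ∀ n : ℕ, x₀ n = -cgh n)
    -- slot-table sockets (the END's), covariance, bond swap; `hdiv` (the ghost Ward rows `hrowgh` are a THEOREM on the ray: discharged inside)
    (hδW : ∀ n, 0 < δW n)
    (hE : ∀ n κ u l u', BiLoc (WE n κ u l u') u u' (CE n) (δW n)) (hJ : ∀ n κ u l u', BiLoc (WJ n κ u l u') u u' (CJ n) (δW n))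
    (hΛ : ∀ n κ u l u', BiLoc (WΛ n κ u l u') u u' (CΛt n) (δW n)) (hR : ∀ n κ u l u', BiLoc (WR n κ u l u') u u' (CRt n) (δW n))
    (hQ : ∀ n κ u l u', BiLoc (WQ n κ u l u') u u' (CQ n) (δW n))
    (hEc : ∀ (n : ℕ) (κ : Fin 4) (u : Site 4) (l : Fin 4) (u' t : Site 4),
      WE n κ (u + (n : ℤ) • t) l (u' + (n : ℤ) • t) = shiftK (-((n : ℤ) • t)) (WE n κ u l u'))
    (hJc : ∀ (n : ℕ) (κ : Fin 4) (u : Site 4) (l : Fin 4) (u' t : Site 4),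
      WJ n κ (u + (n : ℤ) • t) l (u' + (n : ℤ) • t) = shiftK (-((n : ℤ) • t)) (WJ n κ u l u'))
    (hΛc : ∀ (n : ℕ) (κ : Fin 4) (u : Site 4) (l : Fin 4) (u' t : Site 4),
      WΛ n κ (u + (n : ℤ) • t) l (u' + (n : ℤ) • t) = shiftK (-((n : ℤ) • t)) (WΛ n κ u l u'))
    (hRc : ∀ (n : ℕ) (κ : Fin 4) (u : Site 4) (l : Fin 4) (u' t : Site 4),
      WR n κ (u + (n : ℤ) • t) l (u' + (n : ℤ) • t) = shiftK (-((n : ℤ) • t)) (WR n κ u l u'))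
    (hQc : ∀ (n : ℕ) (κ : Fin 4) (u : Site 4) (l : Fin 4) (u' t : Site 4),
      WQ n κ (u + (n : ℤ) • t) l (u' + (n : ℤ) • t) = shiftK (-((n : ℤ) • t)) (WQ n κ u l u'))
    (hEs : ∀ n κ u l u', WE n κ u l u' = WE n l u' κ u) (hJs : ∀ n κ u l u', WJ n κ u l u' = WJ n l u' κ u)
    (hΛs : ∀ n κ u l u', WΛ n κ u l u' = WΛ n l u' κ u) (hRs : ∀ n κ u l u', WR n κ u l u' = WR n l u' κ u)
    (hQs : ∀ n κ u l u', WQ n κ u l u' = WQ n l u' κ u)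
    (hdiv : ∀ n : ℕ, 2 ≤ n → ∀ [NeZero n], ∀ (l' : Fin 4) (u' u : Site 4), ∑ κ' : Fin 4,
      (fineHess n a (SbfBal n a (cE n) (cVH n) (cΛ n) (cR n) (cK n) (cQ n))
          (Wbf (cE₂ n) (cJ4 n) (cΛ₂ n) (cR₂ n) (cQ₂ n) (WE n) (WJ n) (WΛ n) (WR n) (WQ n)) κ' l' (u - Pi.single κ' 1) u'
        - fineHess n a (SbfBal n a (cE n) (cVH n) (cΛ n) (cR n) (cK n) (cQ n))
          (Wbf (cE₂ n) (cJ4 n) (cΛ₂ n) (cR₂ n) (cQ₂ n) (WE n) (WJ n) (WΛ n) (WR n) (WQ n)) κ' l' u u') = 0)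
    -- (LOCAL) slot-E support and units; slot-R envelope and units (the three local ghost bubbles are SUPPLIED under reading (ii))
    {ρE : ℕ} {δ₀ kE : ℝ} (hδ₀ : 0 < δ₀) (hδE : ∀ n, δ₀ ≤ δW n)
    (hsuppE : ∀ n κ u l u', ρE < supNorm (u - u') → WE n κ u l u' = 0)
    (hkE : ∀ n : ℕ, 2 ≤ n → |ωgl n * cE₂ n| * CE n ≤ kE * (n : ℝ) ^ 8)
    {CwR δR : ℕ → ℝ} {θR δ₀R kR : ℝ} (hθR : 0 < θR) (hδR : ∀ n, 0 < δR n) (hδ₀R : 0 < δ₀R) (hδRge : ∀ n : ℕ, δ₀R / n ≤ δR n) (hCwR : ∀ n, 0 ≤ CwR n)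
    (hWRenv : ∀ n κ u l u', BiLoc (WR n κ u l u') u u' (CwR n * Real.exp (-(θR / n) * supNorm (u - u'))) (δR n))
    (hkR : ∀ n : ℕ, 2 ≤ n → |ωgl n * cR₂ n| * CwR n * (n : ℝ) ^ 6 ≤ kR)
    -- (Λ) sockets and zero-momentum data
    (hδT : ∀ n, 0 < δT n)
    (hdec : ∀ n : ℕ, 2 ≤ n → ∀ [NeZero n], ∀ κ u l u', WΛ n κ u l u' =
      (∑ m : Fin 4, OneStepResolventKernel.wsum (onLat n (fun y => lamCoeffOf (KInv (N := n) (d := 3)) n m y l u'))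
          (fun v => onLat n (fun y => TΛ n m y κ u) v))
      + (∑ m : Fin 4, OneStepResolventKernel.wsum (onLat n (fun y => lamCoeffOf (KInv (N := n) (d := 3)) n m y κ u))
          (fun v => onLat n (fun y => TΛ n m y l u') v))
      + WA n κ u l u')
    (hTloc : ∀ (n : ℕ) m y κ u, BiLoc (TΛ n m y κ u) ((n : ℤ) • y) ((n : ℤ) • y) (CT n * Real.exp (-δT n * l1 ((n : ℤ) • y - u))) (δT n))
    (hWAa : ∀ n κ u l u', trK (WA n κ u l u') = -WA n κ u l u') (hWAl : ∀ n κ u l u', Loc (WA n κ u l u'))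
    (hTcov : ∀ (n : ℕ) m y κ u t, TΛ n m (y + t) κ (u + (n : ℤ) • t) = shiftK (-((n : ℤ) • t)) (TΛ n m y κ u))
    (hcΛ : ∀ n : ℕ, 2 ≤ n → cΛ n ≠ 0) (hε : ∀ n : ℕ, ε n = 1 ∨ ε n = -1) (hδx : ∀ n, 0 < δx n) (hX : ∀ n u, BiLoc (X n u) u u (Cx n) (δx n))
    (hW1 : ∀ n : ℕ, 2 ≤ n → ∀ [NeZero n], ∀ u,
      comp (comp (Ga n a) (divV (fun κ v => ε n • SbfBal n a (cE n) (cVH n) (cΛ n) (cR n) (cK n) (cQ n) κ v) u)) (Ga n a) =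
        comp (Ga n a) (X n u) - comp (X n u) (Ga n a))
    (hW2 : ∀ n : ℕ, 2 ≤ n → ∀ [NeZero n], ∀ (m : Fin 4) (u : Site 4),
      divV (fun κ v => (-(ε n * (cΛ₂ n / cΛ n))) • TΛ n m 0 κ v) u = comp (X n u) (ffOf (hessFF n m 0)) - comp (ffOf (hessFF n m 0)) (X n u))
    -- (N) slot Q's SOCKETS (the (A2) readout of `WQ`: a decaying bi-localisation envelope at a BLOCK-scale rate floor and its units line — T₈ ⟸ `NeedleTadpoleRowDecay`)
    {CwQ δQ : ℕ → ℝ} {θQ δ₀Q kQ : ℝ} (hθQ : 0 < θQ) (hδQ : ∀ n, 0 < δQ n) (hδ₀Q : 0 < δ₀Q) (hδQge : ∀ n : ℕ, δ₀Q / n ≤ δQ n) (hCwQ : ∀ n, 0 ≤ CwQ n)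
    (hWQenv : ∀ n κ u l u', BiLoc (WQ n κ u l u') u u' (CwQ n * Real.exp (-(θQ / n) * supNorm (u - u'))) (δQ n))
    (hkQ : ∀ n : ℕ, 2 ≤ n → |ωgl n * cQ₂ n| * CwQ n * (n : ℝ) ^ 6 ≤ kQ)
    -- (U)
    (hU : ∀ n : ℕ, 2 ≤ n → ∀ u, |Ru u n| ≤ CU u) :
    D1Drift Lc (JsB12CombShSym hLc Nt tabs cΛ' cB) N μ ν :=
  d1Drift_JsB12CombShSym_of_hW_reflLettersRem_D1Tel_D1Rep hLc hL2 Nt tabs cΛ' cB hW c Cc δc hC hδc x₂ hX₂ Rm hRmL hRm0 hSrC hWrC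
    a ha h12 h126 hSL k hμν hN Jc htel hc hMw hML
    (d1Rep_BFx_of_D1Tel_ptw_sbpS (JsB12CombShSym hLc Nt tabs cΛ' cB) hμν hN hL2 hLc ha h12 h126 Jc hW
      (axisReflectionCovariant_flipK_TbalOf_JsB12CombShSym_of_reflLettersRem hLc Nt tabs cΛ' cB c Cc δc hC hδc x₂ hX₂ Rm hRmL hRm0 hSrC hWrC)
      htel Rk hptw hMR hRu hU₁ s hs hωs hlam hcE hRsgn hJ4 hcgh hKray hQray hx hδW hE hJ hΛ hR hQ hEc hJc hΛc hRc hQc hEs hJs hΛs hRs hQs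
      hdiv hδ₀ hδE hsuppE hkE hθR hδR hδ₀R hδRge hCwR hWRenv hkR hδT hdec hTloc hWAa hWAl hTcov hcΛ hε hδx hX hW1 hW2 hθQ hδQ hδ₀Q hδQge hCwQ
      hWQenv hkQ hU hSL k)

end Summit.QuantumFields.BalabanUV.Beta.D1BFx.RoadEndBFxJointCombShSym

end
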